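import Literature.MathematicalPhysics.QuantumFieldTheory.Balaban1983to89.B9Eq340TaxiRungs

/-!
# `Balaban1983to89.B9Eq340TaxiTelescope` — T. Bałaban, *Propagators for lattice gauge theories in a background field*, Commun. Math. Phys. **99** (1985) 389–434
# [Balaban1985BackgroundPropagators], (3.40) p. 397 with (3.3) p. 391: THE COVARIANT TELESCOPING OF A TRANSPORTED DIFFERENCE ALONG def-Y's TAXICAB CONTOUR —
# `f(x) − R(U(Γ_{x,x′}))f(x′)` is a transported sum of the covariant differences `(∇_U f)` met along `Γ_{x,x′}`, hence, for unitary-like bond variables,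
# `‖f(x) − R(U(Γ_{x,x′}))f(x′)‖ ≤ |Γ_{x,x′}|·sup_{b ⊂ Γ} ‖(∇_U f)(b)‖ ≤ d·|x − x′|_∞·sup ‖∇_U f‖`, and the (3.40)-quotient form
# `(|x − x′|η)^{−α}‖f(x) − R(U(Γ_{x,x′}))f(x′)‖ ≤ d·(|x − x′|η)^{1−α}·sup ‖η⁻¹∇_U f‖` (the β-interpolation step between the sup norms (3.42)₁,₂ and the Hölder norm (3.40))

statement-level skeleton of published theorems with citation tags; proofs where landed; nothing here is a claim about the Yang–Mills mass gap

THE PRINT.  (3.40) p. 397: *"‖A‖_α = max_μ sup_{x,x′:|x−x′|≦1} |x′ − x|^{−α}|R(U(Γ_{x,x′}))A_μ(x′) − A_μ(x)|, where Γ_{x,x′} is a shortest contour connecting points x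
and x′"*; (3.3) p. 390–391: *"(D^η_{U₀}A)(b) = η⁻¹(R(U₀(b))A(b₊) − A(b₋))"*, `U(Γ) = U(b₁)U(b₂)⋯U(bₙ)`, `R(U)X = UXU⁻¹`; p. 423 (Theorem 3.12): the zeroth-order Hölder
member of a *"first factor"* `G₀Δ⁽²⁾_π…` is read off the sup bounds (3.42)₁,₂ — the mean-value step *"|f(x) − R(U(Γ))f(x′)| ≦ |x − x′|·sup|∇_U f|"* along the contour.

WHY THIS FILE (cell `pub-ymgap`, Track A node N06 [B9], WIDTH-209 piece 1 = W-c, face `hX = Thm33G0DirX` of the certificate of record, seat `pub-ymgap-dag-n06-w6`).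
The knit owner's census (`BINDER-CENSUS-ed25.md` § G, W-c ROUTE NOTE) names as MISSING for the zeroth-order probe member `Thm33G0DirX.pX0` (Φ^X_β∘G₀ : 𝔠⁽⁰⁾ → 𝔠_P^{(β−2)},
the β-interpolate of (3.42)₁,₂ through the quotients (3.40)) *"the telescoping lemma over def-Y's taxi paths (`parTaxiV ∕ taxiSteps`) … `|f(x) − R(U(Γ))f(x′)| ≤ |x−x′|·sup|∇_U f|`"*.
def-Y's transporter `Node00.OpsYTransport.parTaxiV` IS a signed step run (`B9Eq340StepLasso.parTaxiV_eq_stepRun`, n06-i), whose rungs `rungSites` and length are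
book-kept in `B9Eq340StepLasso ∕ B9Eq340TaxiRungs` for the LASSO holonomies; THIS FILE adds the companion bookkeeping for a FIELD `f : sites → 𝔸` transported along the path.

WHAT IS PROVED (sorry-free; no new definitions — the transported difference is written out as `f w − R (stepRun U l w) (f (stepEnd l w))`).
* §1 (any ring-normed `𝔸`, any configuration): the one-step recursions `gap_cons_true ∕ gap_cons_false` (a forward step contributes `−(∇_{U,ν}f)(w)`, a backward step
  `R(U_ν(w−e_ν)⁻¹)(∇_{U,ν}f)(w−e_ν)`, the tail transported by the step's bond variable), `gap_nil`, `gap_append` (concatenation = first gap + transported second gap) —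
  with `∇_{U,ν}f = B9Eq39Adjoint.covD (shiftsV1 P) U ν f` (print's (3.3) at `η = 1`, def-Y's `cdS ∕ cdB` up to the chart ∕ the factor `c_f`).
* §2 (unitary-like bond variables, `T4RelativeLadder.UnitaryLike`: `‖u‖ ≤ 1 ∧ ‖u⁻¹‖ ≤ 1`): `norm_R_le` (`‖R(u)X‖ ≤ ‖X‖`), ★★ `norm_gap_le_sum` (`‖f(w) − R(U(Γ))f(end)‖ ≤ Σ_{rungs}
  ‖(∇_{U,ν_r}f)(v_r)‖` over `rungSites`), ★★ `norm_gap_le_length_mul` (a uniform bound `δ` on the met covariant differences gives `≤ |Γ|·δ`).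
* §3 (def-Y's taxicab): `stepEnd_taxiSteps` (the run ends at `x′`), `length_taxiSteps_eq_tdist` (`|Γ_{x,x′}| = |x − x′|₁`), `length_taxiSteps_le_mul_supDist` (`≤ d·|x − x′|_∞`),
  ★ `supDist_rungSites_taxiSteps_le` (every rung `v` of `Γ_{x,x′}` and its successor have `|x − v|_∞ ≤ |x − x′|_∞`: the contour of a near pair stays in `Δ̃(y)`),
  ★★★ `norm_sub_R_parTaxiV_le` (rung-localised hypothesis), `norm_sub_R_parTaxiV_le_supDist_of_rungs` ∕ ★★★ `norm_sub_R_parTaxiV_le_supDist` (`≤ d·|x − x′|_∞·δ`,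
  rung-localised ∕ global sup hypothesis), ★★★ `holderWeight_mul_norm_sub_R_parTaxiV_le_of_rungs` ∕ `holderWeight_mul_norm_sub_R_parTaxiV_le` — the (3.40)-QUOTIENT FORM `(|x − x′|_∞η)^{−α}·‖f(x) − R(U(Γ_{x,x′}))f(x′)‖ ≤ d·(|x − x′|_∞η)^{1−α}·D` whenever
  `‖(∇_{U,μ}f)(y)‖ ≤ η·D` everywhere (every real `α`; the weight is def-Y's `wK` ∕ `holderQB` weight at `η = |c_f|⁻¹`), and ★★★ `holderWeight_mul_norm_sub_R_parTaxiV_le_of_rungs_of_le` ∕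
  `holderWeight_mul_norm_sub_R_parTaxiV_le_of_le` — for the NEAR pairs `|x − x′|_∞η ≤ ℓ₀` (print's «|x − x′| ≦ 1», def-Y's `Adm`) and `α ≤ 1`: `≤ d·ℓ₀^{1−α}·D`, i.e. the `(Lʲη)^{2−α}`-weighted zeroth-order Hölder member of p. 423.
* §4 (at an index `i : KIdx`, def-Y's letters): `cdB_eq_smul_covD_slice` (`rfl` dictionary) and `norm_covD_slice_eq` (`‖covD … (ν-slice of A)‖ = |c_f|⁻¹·‖(cdB i U μ A)(b)‖`),
  ★ `norm_sub_R_parBY_le_of_cdB` — for two bonds of the SAME direction, `‖A(x) − R(parBY i U x.src x′.src)A(x′)‖ ≤ (d+1)·|x.src − x′.src|_∞·|c_f|⁻¹·sup_{μ, b ∥ x} ‖(∇_{U,μ}A)(b)‖`.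

HONEST SCOPE.  Elementary covariant lattice calculus over def-Y's genuine transporters; nothing of [B9] is asserted; the unitarity enters only through `‖u‖, ‖u⁻¹‖ ≤ 1`.
This is ONE input of the W-c face `hX.pX0` (the mean-value step); the assembly of `pX0` at the certificate's pins is NOT done here — in particular the probe
lattice `B9CoReadingCoordsHolder.PK` carries pair probes for ALL pairs `(x, x′)`, and for pairs with `|x − x′|_∞ > L^{j(x)}` (non-admissible in def-Y's `holderQB`)
the contour leaves `Δ̃(y)`: that bookkeeping is the consumer's (LOCATED on the cell bus by this seat).  COUNT-NEUTRAL; N06 NOT discharged; one finite torus at a time;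
nothing continuum, nothing about the mass gap.  Cell `pub-ymgap` (HUMAN RULING D-0062), Track A node N06 [B9], seat `pub-ymgap-dag-n06-w6` (g0), 2026-08-28; a NEW file.
-/

namespace Literature.MathematicalPhysics.QuantumFieldTheory.Balaban1983to89.B9Eq340TaxiTelescope

open B9BackgroundsKLevelV1 (CfgV1 shiftsV1)
open B9Eq39Adjoint (R R_def R_sub R_one R_inv_R covD)
open Node00 (parTaxiV parTaxiV_self taxiEnd_eq taxiRun)
open B9Eq340StepLasso (stepRun stepEnd rungSites legSteps taxiSteps stepRun_append stepEnd_append length_rungSites parTaxiV_eq_stepRun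
  taxiRun_eq_stepRun)
open B9Eq340TaxiRungs (length_taxiSteps_le length_legSteps OnArc rungSites_taxiSteps)
open T4RelativeLadder (UnitaryLike norm_unit_mul_le norm_mul_unit_le)
open B10StarCount (shift_unshift)
open LatticeFieldCalculus (supDist)
open B3TorusRadialSums (cdist cdist_le_supDist supDist_eq_zero_iff)

noncomputable section

variable {P : Params} {𝔸 : Type} [NormedRing 𝔸]

/-! ## §1 The transported difference along a signed step path: one-step recursions and concatenation -/

/-- the torus shifts of the V1 carrier act by `x ↦ x + e_μ`. [cite: Balaban1985BackgroundPropagators, (3.1) p.390, dictionary] -/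
private theorem shiftsV1_apply' (μ : Fin P.d) (x : Site P 0) : shiftsV1 P μ x = x.shift μ := rfl

/-- the empty contour: `f(w) − R(1)f(w) = 0`. [cite: Balaban1985BackgroundPropagators, (3.40) p.397, bookkeeping] -/
theorem gap_nil (U : CfgV1 P 𝔸) (f : Site P 0 → 𝔸) (w : Site P 0) :
    f w - R (stepRun U [] w) (f (stepEnd [] w)) = 0 := by
  simp [stepRun, stepEnd]

/-- ★ **ONE MORE FORWARD STEP** `⟨w, w+e_ν⟩`: `f(w) − R(U_ν(w)U(Γ′))f(end) = −(∇_{U,ν}f)(w) + R(U_ν(w))·[f(w+e_ν) − R(U(Γ′))f(end)]`, with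
`(∇_{U,ν}f)(w) = R(U_ν(w))f(w+e_ν) − f(w)` ((3.3) at `η = 1`). [cite: Balaban1985BackgroundPropagators, (3.3) p.391, (3.40) p.397] -/
theorem gap_cons_true (U : CfgV1 P 𝔸) (f : Site P 0 → 𝔸) (ν : Fin P.d) (l : List (Fin P.d × Bool)) (w : Site P 0) :
    f w - R (stepRun U ((ν, true) :: l) w) (f (stepEnd ((ν, true) :: l) w)) =
      -covD (shiftsV1 P) U ν f w + R (U ν w) (f (w.shift ν) - R (stepRun U l (w.shift ν)) (f (stepEnd l (w.shift ν)))) := by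
  simp only [stepRun, stepEnd, covD, shiftsV1_apply', B9Eq39Adjoint.R_mul, R_sub]
  abel

/-- ★ **ONE MORE BACKWARD STEP** `⟨w, w−e_ν⟩` (the bond `⟨w−e_ν, w⟩` traversed against its orientation, variable `U_ν(w−e_ν)⁻¹` by (3.5)):
`f(w) − R(U_ν(w−e_ν)⁻¹U(Γ′))f(end) = R(U_ν(w−e_ν)⁻¹)(∇_{U,ν}f)(w−e_ν) + R(U_ν(w−e_ν)⁻¹)·[f(w−e_ν) − R(U(Γ′))f(end)]`.
[cite: Balaban1985BackgroundPropagators, (3.3), (3.5) p.391, (3.40) p.397] -/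
theorem gap_cons_false (U : CfgV1 P 𝔸) (f : Site P 0 → 𝔸) (ν : Fin P.d) (l : List (Fin P.d × Bool)) (w : Site P 0) :
    f w - R (stepRun U ((ν, false) :: l) w) (f (stepEnd ((ν, false) :: l) w)) =
      R (U ν (w.unshift ν))⁻¹ (covD (shiftsV1 P) U ν f (w.unshift ν)) +
        R (U ν (w.unshift ν))⁻¹ (f (w.unshift ν) - R (stepRun U l (w.unshift ν)) (f (stepEnd l (w.unshift ν)))) := by
  simp only [stepRun, stepEnd, covD, shiftsV1_apply', shift_unshift, B9Eq39Adjoint.R_mul, R_sub, R_inv_R]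
  abel

/-- **CONCATENATION**: along `Γ₁Γ₂` the transported difference is the one along `Γ₁` plus the one along `Γ₂` transported back by `U(Γ₁)` (`U(Γ₁Γ₂) = U(Γ₁)U(Γ₂)`,
`R(UV) = R(U)R(V)`). [cite: Balaban1985BackgroundPropagators, (3.3) p.391 (U(Γ) = U(b₁)⋯U(bₙ)), (3.40) p.397] -/
theorem gap_append (U : CfgV1 P 𝔸) (f : Site P 0 → 𝔸) (l₁ l₂ : List (Fin P.d × Bool)) (w : Site P 0) :
    f w - R (stepRun U (l₁ ++ l₂) w) (f (stepEnd (l₁ ++ l₂) w)) =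
      (f w - R (stepRun U l₁ w) (f (stepEnd l₁ w))) +
        R (stepRun U l₁ w) (f (stepEnd l₁ w) - R (stepRun U l₂ (stepEnd l₁ w)) (f (stepEnd l₂ (stepEnd l₁ w)))) := by
  rw [stepRun_append, stepEnd_append, B9Eq39Adjoint.R_mul, R_sub]
  abel

/-! ## §2 Norm bounds for unitary-like bond variables -/

/-- `‖R(u)X‖ = ‖uXu⁻¹‖ ≤ ‖X‖` when `‖u‖ ≤ 1` and `‖u⁻¹‖ ≤ 1` (e.g. `u` unitary in a C⋆-algebra: `R(u)` is an isometry of `𝔤`).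
[cite: Balaban1985BackgroundPropagators, (3.40) p.397 (R(U(Γ)) on 𝔤-valued functions), folklore] -/
theorem norm_R_le {u : 𝔸ˣ} (hu : UnitaryLike u) (X : 𝔸) : ‖R u X‖ ≤ ‖X‖ := by
  rw [R_def]
  exact (norm_mul_unit_le hu.inv _).trans (norm_unit_mul_le hu X)

/-- ★★ **THE TELESCOPING BOUND ALONG A SIGNED STEP PATH**: for unitary-like bond variables, `‖f(w) − R(U(Γ))f(end Γ)‖ ≤ Σ_{rungs (v, ν, ±) of Γ} ‖(∇_{U,ν}f)(v)‖` — a forward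
`ν`-step at `v` contributes `‖(∇_{U,ν}f)(v)‖`, a backward one from `v + e_ν` contributes `‖(∇_{U,ν}f)(v)‖` as well (`rungSites` lists exactly these base points).
[cite: Balaban1985BackgroundPropagators, (3.40) p.397, (3.3) p.391, p.423 (the zeroth-order Hölder member from the sup bounds)] -/
theorem norm_gap_le_sum {U : CfgV1 P 𝔸} (hU : ∀ μ x, UnitaryLike (U μ x)) (f : Site P 0 → 𝔸) :
    ∀ (l : List (Fin P.d × Bool)) (w : Site P 0),
      ‖f w - R (stepRun U l w) (f (stepEnd l w))‖ ≤ ((rungSites l w).map fun r => ‖covD (shiftsV1 P) U r.2.1 f r.1‖).sum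
  | [], w => by simp [stepRun, stepEnd, rungSites]
  | (ν, true) :: l, w => by
    rw [gap_cons_true]
    simp only [rungSites, List.map_cons, List.sum_cons]
    refine (norm_add_le _ _).trans (add_le_add (le_of_eq (norm_neg _)) ?_)
    exact (norm_R_le (hU ν w) _).trans (norm_gap_le_sum hU f l _)
  | (ν, false) :: l, w => by
    rw [gap_cons_false]
    simp only [rungSites, List.map_cons, List.sum_cons]
    refine (norm_add_le _ _).trans (add_le_add (norm_R_le (hU ν _).inv _) ?_)
    exact (norm_R_le (hU ν _).inv _).trans (norm_gap_le_sum hU f l _)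

/-- ★★ **UNIFORM FORM**: if every covariant difference met along `Γ` is `≤ δ` in norm, then `‖f(w) − R(U(Γ))f(end Γ)‖ ≤ |Γ|·δ` (`|Γ|` = the number of bonds of the contour).
[cite: Balaban1985BackgroundPropagators, (3.40) p.397, (3.3) p.391, p.423] -/
theorem norm_gap_le_length_mul {U : CfgV1 P 𝔸} (hU : ∀ μ x, UnitaryLike (U μ x)) (f : Site P 0 → 𝔸) {δ : ℝ} :
    ∀ (l : List (Fin P.d × Bool)) (w : Site P 0), (∀ r ∈ rungSites l w, ‖covD (shiftsV1 P) U r.2.1 f r.1‖ ≤ δ) →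
      ‖f w - R (stepRun U l w) (f (stepEnd l w))‖ ≤ l.length * δ
  | [], w, _ => by simp [stepRun, stepEnd]
  | (ν, true) :: l, w, h => by
    rw [gap_cons_true]
    have h1 : ‖covD (shiftsV1 P) U ν f w‖ ≤ δ := by simpa using h (w, ν, true) (by simp [rungSites])
    have h2 := norm_gap_le_length_mul hU f l (w.shift ν) fun r hr => h r (by simp [rungSites, hr])
    simp only [List.length_cons, Nat.cast_succ]
    calc ‖-covD (shiftsV1 P) U ν f w + R (U ν w) (f (w.shift ν) - R (stepRun U l (w.shift ν)) (f (stepEnd l (w.shift ν))))‖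
        ≤ ‖covD (shiftsV1 P) U ν f w‖ + ‖f (w.shift ν) - R (stepRun U l (w.shift ν)) (f (stepEnd l (w.shift ν)))‖ :=
          (norm_add_le _ _).trans (add_le_add (le_of_eq (norm_neg _)) (norm_R_le (hU ν w) _))
      _ ≤ δ + l.length * δ := add_le_add h1 h2
      _ = (l.length + 1) * δ := by ring
  | (ν, false) :: l, w, h => by
    rw [gap_cons_false]
    have h1 : ‖covD (shiftsV1 P) U ν f (w.unshift ν)‖ ≤ δ := by simpa using h (w.unshift ν, ν, false) (by simp [rungSites])
    have h2 := norm_gap_le_length_mul hU f l (w.unshift ν) fun r hr => h r (by simp [rungSites, hr])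
    simp only [List.length_cons, Nat.cast_succ]
    calc ‖R (U ν (w.unshift ν))⁻¹ (covD (shiftsV1 P) U ν f (w.unshift ν)) +
          R (U ν (w.unshift ν))⁻¹ (f (w.unshift ν) - R (stepRun U l (w.unshift ν)) (f (stepEnd l (w.unshift ν))))‖
        ≤ ‖covD (shiftsV1 P) U ν f (w.unshift ν)‖ + ‖f (w.unshift ν) - R (stepRun U l (w.unshift ν)) (f (stepEnd l (w.unshift ν)))‖ :=
          (norm_add_le _ _).trans (add_le_add (norm_R_le (hU ν _).inv _) (norm_R_le (hU ν _).inv _))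
      _ ≤ δ + l.length * δ := add_le_add h1 h2
      _ = (l.length + 1) * δ := by ring

/-! ## §3 At def-Y's taxicab transporter `U(Γ_{x,x′}) = parTaxiV U x x′` -/

/-- the taxicab run from `x` towards `x′` ENDS at `x′` (def-Y's `taxiEnd_eq`, read on the signed step path). [cite: Balaban1985BackgroundPropagators, (3.40) p.397 («contour connecting points x and x′»)] -/
theorem stepEnd_taxiSteps (x z : Site P 0) : stepEnd (taxiSteps (List.finRange P.d) x z) x = z := by
  have h := congrArg Prod.fst (taxiRun_eq_stepRun (fun _ _ => (1 : (ℤ)ˣ)) z (List.finRange P.d) (List.nodup_finRange _) (x, 1))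
  have h2 := taxiEnd_eq (fun _ _ => (1 : (ℤ)ˣ)) x z
  unfold Node00.taxiEnd at h2
  rw [h] at h2
  exact h2

/-- the transported difference along def-Y's taxicab run IS `f(x) − R(U(Γ_{x,x′}))f(x′)`. [cite: Balaban1985BackgroundPropagators, (3.40) p.397, (3.3) p.391] -/
theorem gap_taxiSteps (U : CfgV1 P 𝔸) (f : Site P 0 → 𝔸) (x z : Site P 0) :
    f x - R (stepRun U (taxiSteps (List.finRange P.d) x z) x) (f (stepEnd (taxiSteps (List.finRange P.d) x z) x)) =
      f x - R (parTaxiV U x z) (f z) := by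
  rw [stepEnd_taxiSteps, ← parTaxiV_eq_stepRun]

/-- the number of bonds of the legs `l`: `Σ_{ν ∈ l} min(forward count, backward count)`. [cite: Balaban1985BackgroundPropagators, (3.40) p.397 («a shortest contour»), bookkeeping] -/
theorem length_taxiSteps_eq_sum (p z : Site P 0) :
    ∀ l : List (Fin P.d), (taxiSteps l p z).length = (l.map fun ν => min (z ν - p ν).val (p ν - z ν).val).sum
  | [] => by simp [taxiSteps]
  | ν :: l => by
    simp only [taxiSteps, List.length_append, length_legSteps, List.map_cons, List.sum_cons, length_taxiSteps_eq_sum p z l]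
    rw [min_def]

/-- ★ `|Γ_{x,x′}| = |x − x′|₁`: def-Y's taxicab contour is a SHORTEST contour in the `ℓ¹` torus metric `Site.tdist`. [cite: Balaban1985BackgroundPropagators, (3.40) p.397 («a shortest contour connecting points x and x′»)] -/
theorem length_taxiSteps_eq_tdist (x z : Site P 0) : (taxiSteps (List.finRange P.d) x z).length = Site.tdist x z := by
  rw [length_taxiSteps_eq_sum, Site.tdist, Fin.sum_univ_def]
  congr 1
  refine List.map_congr_left fun ν _ => ?_
  rw [min_comm]

/-- `|Γ_{x,x′}| ≤ d·|x − x′|_∞` (each leg is at most the `ℓ^∞` torus distance `LatticeFieldCalculus.supDist`). [cite: Balaban1985BackgroundPropagators, (3.40) p.397, bookkeeping] -/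
theorem length_taxiSteps_le_mul_supDist (x z : Site P 0) : (taxiSteps (List.finRange P.d) x z).length ≤ P.d * supDist x z := by
  have h := length_taxiSteps_le x z (K := supDist x z) (fun ν => ?_) (List.finRange P.d)
  · simpa [List.length_finRange] using h
  · have hc := cdist_le_supDist x z ν
    simp only [cdist, neg_sub] at hc
    rwa [min_comm] at hc

/-- on the shorter arc from `c` to `t`, the circular distance to `c` is at most that of `t`. [cite: Balaban1985BackgroundPropagators, (3.40) p.397 («a shortest contour»), bookkeeping] -/
theorem min_val_le_of_onArc {n : ℕ} [NeZero n] {c t u : ZMod n} (h : OnArc c t u) :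
    min (c - u).val (u - c).val ≤ min (c - t).val (t - c).val := by
  unfold OnArc at h
  split_ifs at h with hct
  · calc min (c - u).val (u - c).val ≤ (u - c).val := min_le_right _ _
      _ ≤ (t - c).val := h
      _ = min (c - t).val (t - c).val := (min_eq_right hct).symm
  · calc min (c - u).val (u - c).val ≤ (c - u).val := min_le_left _ _
      _ ≤ (c - t).val := h
      _ = min (c - t).val (t - c).val := (min_eq_left (not_le.1 hct).le).symm

/-- ★ **THE CONTOUR STAYS `ℓ^∞`-CLOSE TO ITS START**: every rung site `v` of def-Y's taxicab contour `Γ_{x,x′}`, and its successor `v + e_ν`, satisfy `|x − v|_∞ ≤ |x − x′|_∞`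
(coordinatewise on the shorter arcs, n06-i's `rungSites_taxiSteps`) — so for a near pair `|x − x′|_∞ ≤ Lʲ` the whole contour lies within `Lʲ` of `x`, inside `Δ̃(y)`.
[cite: Balaban1985BackgroundPropagators, (3.40) p.397 («x, x′ ∈ Δ̃(y)», «a shortest contour»)] -/
theorem supDist_rungSites_taxiSteps_le (x z : Site P 0) :
    ∀ r ∈ rungSites (taxiSteps (List.finRange P.d) x z) x, supDist x r.1 ≤ supDist x z ∧ supDist x (r.1.shift r.2.1) ≤ supDist x z := by
  intro r hr
  obtain ⟨-, -, hon⟩ := rungSites_taxiSteps z (List.finRange P.d) (List.nodup_finRange _) x r hr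
  have key : ∀ w : Site P 0, (∀ μ, OnArc (x μ) (z μ) (w μ)) → supDist x w ≤ supDist x z := fun w hw =>
    Finset.sup_le fun μ _ => (min_val_le_of_onArc (hw μ)).trans
      (Finset.le_sup (f := fun μ : Fin P.d => min (x μ - z μ).val (z μ - x μ).val) (Finset.mem_univ μ))
  exact ⟨key _ fun μ => (hon μ (List.mem_finRange μ)).1, key _ fun μ => (hon μ (List.mem_finRange μ)).2⟩

/-- ★★★ **THE TELESCOPING BOUND ALONG def-Y's TAXICAB CONTOUR (rung-localised)**: for unitary-like bond variables, if every covariant difference `(∇_{U,ν}f)(v)` at the rungs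
of `Γ_{x,x′}` is `≤ δ` in norm, then `‖f(x) − R(U(Γ_{x,x′}))f(x′)‖ ≤ |Γ_{x,x′}|·δ` (where the rungs lie: `B9Eq340TaxiRungs.rungSites_taxiSteps` — coordinatewise on the shorter arcs
between `x` and `x′`). [cite: Balaban1985BackgroundPropagators, (3.40) p.397, (3.3) p.391, p.423] -/
theorem norm_sub_R_parTaxiV_le {U : CfgV1 P 𝔸} (hU : ∀ μ x, UnitaryLike (U μ x)) (f : Site P 0 → 𝔸) (x z : Site P 0) {δ : ℝ}
    (h : ∀ r ∈ rungSites (taxiSteps (List.finRange P.d) x z) x, ‖covD (shiftsV1 P) U r.2.1 f r.1‖ ≤ δ) :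
    ‖f x - R (parTaxiV U x z) (f z)‖ ≤ (taxiSteps (List.finRange P.d) x z).length * δ := by
  rw [← gap_taxiSteps]
  exact norm_gap_le_length_mul hU f _ x h

/-- ★★★ **RUNG-LOCALISED `ℓ^∞` FORM**: for unitary-like bond variables, if the covariant differences at the rungs of `Γ_{x,x′}` are `≤ δ` (`δ ≥ 0`), then
`‖f(x) − R(U(Γ_{x,x′}))f(x′)‖ ≤ d·|x − x′|_∞·δ`. [cite: Balaban1985BackgroundPropagators, (3.40) p.397, (3.3) p.391, p.423] -/
theorem norm_sub_R_parTaxiV_le_supDist_of_rungs {U : CfgV1 P 𝔸} (hU : ∀ μ x, UnitaryLike (U μ x)) (f : Site P 0 → 𝔸) (x z : Site P 0) {δ : ℝ}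
    (hδ : 0 ≤ δ) (h : ∀ r ∈ rungSites (taxiSteps (List.finRange P.d) x z) x, ‖covD (shiftsV1 P) U r.2.1 f r.1‖ ≤ δ) :
    ‖f x - R (parTaxiV U x z) (f z)‖ ≤ P.d * supDist x z * δ := by
  refine (norm_sub_R_parTaxiV_le hU f x z h).trans ?_
  have h' : ((taxiSteps (List.finRange P.d) x z).length : ℝ) ≤ (P.d : ℝ) * (supDist x z : ℝ) := by
    exact_mod_cast length_taxiSteps_le_mul_supDist x z
  exact mul_le_mul_of_nonneg_right h' hδ

/-- ★★★ **GLOBAL-SUP FORM** — print's mean-value step *"|f(x) − R(U(Γ_{x,x′}))f(x′)| ≦ |x − x′|·sup|∇_U f|"*: for unitary-like bond variables and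
`‖(∇_{U,μ}f)(y)‖ ≤ δ` for all `μ, y`: `‖f(x) − R(U(Γ_{x,x′}))f(x′)‖ ≤ d·|x − x′|_∞·δ`. [cite: Balaban1985BackgroundPropagators, (3.40) p.397, (3.3) p.391, p.423] -/
theorem norm_sub_R_parTaxiV_le_supDist {U : CfgV1 P 𝔸} (hU : ∀ μ x, UnitaryLike (U μ x)) (f : Site P 0 → 𝔸) {δ : ℝ} (hδ : 0 ≤ δ)
    (h : ∀ (μ : Fin P.d) (y : Site P 0), ‖covD (shiftsV1 P) U μ f y‖ ≤ δ) (x z : Site P 0) :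
    ‖f x - R (parTaxiV U x z) (f z)‖ ≤ P.d * supDist x z * δ :=
  norm_sub_R_parTaxiV_le_supDist_of_rungs hU f x z hδ fun r _ => h r.2.1 r.1

/-- ★★★ **THE (3.40)-QUOTIENT FORM, RUNG-LOCALISED**: with the covariant Hölder weight `(|x − x′|_∞·η)^{−α}` and a bound `‖(∇_{U,ν}f)(v)‖ ≤ η·D` at the rungs of `Γ_{x,x′}`
only, for every real `α`: `(|x − x′|_∞η)^{−α}·‖f(x) − R(U(Γ_{x,x′}))f(x′)‖ ≤ d·(|x − x′|_∞η)^{1−α}·D`. [cite: Balaban1985BackgroundPropagators, (3.40) p.397, (3.42) p.397, p.423] -/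
theorem holderWeight_mul_norm_sub_R_parTaxiV_le_of_rungs {U : CfgV1 P 𝔸} (hU : ∀ μ x, UnitaryLike (U μ x)) (f : Site P 0 → 𝔸) {η D : ℝ} (hη : 0 < η)
    (hD : 0 ≤ D) (α : ℝ) (x z : Site P 0)
    (h : ∀ r ∈ rungSites (taxiSteps (List.finRange P.d) x z) x, ‖covD (shiftsV1 P) U r.2.1 f r.1‖ ≤ η * D) :
    ((supDist x z : ℝ) * η) ^ (-α) * ‖f x - R (parTaxiV U x z) (f z)‖ ≤ P.d * ((supDist x z : ℝ) * η) ^ (1 - α) * D := by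
  rcases Nat.eq_zero_or_pos (supDist x z) with h0 | hpos
  · have hxz : x = z := (supDist_eq_zero_iff x z).1 h0
    subst hxz
    rw [parTaxiV_self, R_one, sub_self, norm_zero, mul_zero]
    exact mul_nonneg (mul_nonneg (Nat.cast_nonneg _) (Real.rpow_nonneg (mul_nonneg (Nat.cast_nonneg _) hη.le) _)) hD
  · set t : ℝ := (supDist x z : ℝ) * η with ht
    have htpos : 0 < t := mul_pos (by exact_mod_cast hpos) hη
    have hb := norm_sub_R_parTaxiV_le_supDist_of_rungs hU f x z (mul_nonneg hη.le hD) h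
    have hw : 0 ≤ t ^ (-α) := Real.rpow_nonneg htpos.le _
    calc t ^ (-α) * ‖f x - R (parTaxiV U x z) (f z)‖ ≤ t ^ (-α) * (P.d * supDist x z * (η * D)) := mul_le_mul_of_nonneg_left hb hw
      _ = P.d * (t ^ (-α) * t ^ (1 : ℝ)) * D := by rw [Real.rpow_one, ht]; ring
      _ = P.d * t ^ (1 - α) * D := by rw [← Real.rpow_add htpos]; ring_nf

/-- ★★★ **THE (3.40)-QUOTIENT FORM (the β-interpolation step)**: with the covariant Hölder weight `(|x − x′|_∞·η)^{−α}` of def-Y's `holderQB` ∕ `B9CoReadingCoordsHolder.wK`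
(`η` the lattice spacing, `|c_f|⁻¹` at an index) and a bound `‖(∇_{U,μ}f)(y)‖ ≤ η·D` on the lattice-unit covariant differences (i.e. `D` bounds the physical covariant
derivative `η⁻¹∇_U f` of (3.3)), for every real `α`: `(|x − x′|_∞η)^{−α}·‖f(x) − R(U(Γ_{x,x′}))f(x′)‖ ≤ d·(|x − x′|_∞η)^{1−α}·D` (at `x = x′` both sides vanish ∕ are `≥ 0`).
With `|x − x′|_∞η ≤ Lʲη` and `D = B₀(Lʲη)e^{−δ₀d}|λ|` from (3.42)₂ this is the `(Lʲη)^{2−α}`-weighted zeroth-order Hölder member of p. 423.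
[cite: Balaban1985BackgroundPropagators, (3.40) p.397, (3.42) p.397, p.423] -/
theorem holderWeight_mul_norm_sub_R_parTaxiV_le {U : CfgV1 P 𝔸} (hU : ∀ μ x, UnitaryLike (U μ x)) (f : Site P 0 → 𝔸) {η D : ℝ} (hη : 0 < η) (hD : 0 ≤ D)
    (h : ∀ (μ : Fin P.d) (y : Site P 0), ‖covD (shiftsV1 P) U μ f y‖ ≤ η * D) (α : ℝ) (x z : Site P 0) :
    ((supDist x z : ℝ) * η) ^ (-α) * ‖f x - R (parTaxiV U x z) (f z)‖ ≤ P.d * ((supDist x z : ℝ) * η) ^ (1 - α) * D :=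
  holderWeight_mul_norm_sub_R_parTaxiV_le_of_rungs hU f hη hD α x z fun r _ => h r.2.1 r.1

/-- ★★★ **ADMISSIBLE PAIRS, RUNG-LOCALISED: THE `(Lʲη)^{1−α}`-WEIGHTED FORM** — for a near pair `|x − x′|_∞η ≤ ℓ₀`, `α ≤ 1`, and covariant differences `≤ η·D` at the
rungs of `Γ_{x,x′}`: `(|x − x′|_∞η)^{−α}·‖f(x) − R(U(Γ_{x,x′}))f(x′)‖ ≤ d·ℓ₀^{1−α}·D`. [cite: Balaban1985BackgroundPropagators, (3.40) p.397 («|x−x′| ≦ 1»), (3.42) p.397, p.423] -/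
theorem holderWeight_mul_norm_sub_R_parTaxiV_le_of_rungs_of_le {U : CfgV1 P 𝔸} (hU : ∀ μ x, UnitaryLike (U μ x)) (f : Site P 0 → 𝔸) {η D ℓ₀ : ℝ}
    (hη : 0 < η) (hD : 0 ≤ D) {α : ℝ} (hα : α ≤ 1) (x z : Site P 0) (hnear : (supDist x z : ℝ) * η ≤ ℓ₀)
    (h : ∀ r ∈ rungSites (taxiSteps (List.finRange P.d) x z) x, ‖covD (shiftsV1 P) U r.2.1 f r.1‖ ≤ η * D) :
    ((supDist x z : ℝ) * η) ^ (-α) * ‖f x - R (parTaxiV U x z) (f z)‖ ≤ P.d * ℓ₀ ^ (1 - α) * D := by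
  refine (holderWeight_mul_norm_sub_R_parTaxiV_le_of_rungs hU f hη hD α x z h).trans ?_
  have ht0 : 0 ≤ (supDist x z : ℝ) * η := mul_nonneg (Nat.cast_nonneg _) hη.le
  have hpow : ((supDist x z : ℝ) * η) ^ (1 - α) ≤ ℓ₀ ^ (1 - α) := Real.rpow_le_rpow ht0 hnear (by linarith)
  exact mul_le_mul_of_nonneg_right (mul_le_mul_of_nonneg_left hpow (Nat.cast_nonneg _)) hD

/-- ★★★ **ADMISSIBLE PAIRS: THE `(Lʲη)^{1−α}`-WEIGHTED FORM** — for a pair inside the cut-off scale, `|x − x′|_∞η ≤ ℓ` (print's *"|x − x′| ≦ 1"* in units of `ξ⁻¹ = Lʲη`;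
def-Y's `Adm`: `|x − x′|_∞ ≤ L^{j(x)}`), and `α ≤ 1`: `(|x − x′|_∞η)^{−α}·‖f(x) − R(U(Γ_{x,x′}))f(x′)‖ ≤ d·ℓ^{1−α}·D`.  With `D = B₀(Lʲη)e^{−δ₀d(y,y′)}|λ|` from
(3.42)₂ and `ℓ = Lʲη` this is `d·B₀·(Lʲη)^{2−α}e^{−δ₀d(y,y′)}|λ|` — the zeroth-order Hölder member of p. 423 for the near pairs.
[cite: Balaban1985BackgroundPropagators, (3.40) p.397 («|x−x′| ≦ 1»), (3.42) p.397, p.423] -/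
theorem holderWeight_mul_norm_sub_R_parTaxiV_le_of_le {U : CfgV1 P 𝔸} (hU : ∀ μ x, UnitaryLike (U μ x)) (f : Site P 0 → 𝔸) {η D ℓ₀ : ℝ} (hη : 0 < η)
    (hD : 0 ≤ D) (h : ∀ (μ : Fin P.d) (y : Site P 0), ‖covD (shiftsV1 P) U μ f y‖ ≤ η * D) {α : ℝ} (hα : α ≤ 1) (x z : Site P 0)
    (hnear : (supDist x z : ℝ) * η ≤ ℓ₀) :
    ((supDist x z : ℝ) * η) ^ (-α) * ‖f x - R (parTaxiV U x z) (f z)‖ ≤ P.d * ℓ₀ ^ (1 - α) * D :=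
  holderWeight_mul_norm_sub_R_parTaxiV_le_of_rungs_of_le hU f hη hD hα x z hnear fun r _ => h r.2.1 r.1

end

/-! ## §4 At an index: def-Y's bond-sector letters `cdB`, `parBY` -/

noncomputable section

open B6KLevelCensusIndexV1 (KIdx)
open B6GlobalChartV1 (PV)
open Node00 (CfgY FBondY cdB parBY)

variable {d ℓ : ℕ} {hd : 1 ≤ d + 1} {hL : Odd (ℓ + 1) ∧ 1 < ℓ + 1} {b₀ b₁ : ℝ}
variable {𝔸 : Type} [NormedRing 𝔸] [NormedAlgebra ℂ 𝔸] [CompleteSpace 𝔸]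

/-- dictionary (`rfl`): def-Y's bond-sector covariant derivative `(∇_{U,μ}A)_ν(x) = c_f·(R(U_μ(x))A_ν(x+e_μ) − A_ν(x))` is `c_f` times the lattice-unit `covD` of the `ν`-SLICE
`s ↦ A⟨s, ν⟩` at the source of the bond. [cite: Balaban1985BackgroundPropagators, (3.3) p.391, (3.39) p.397, dictionary] -/
theorem cdB_eq_smul_covD_slice (i : KIdx d ℓ hd hL b₀ b₁) (U : CfgY 𝔸 i) (μ : Fin (d + 1)) (A : FBondY i → 𝔸) (b : FBondY i) :
    cdB i U μ A b = ((i.cf : ℝ) : ℂ) • covD (shiftsV1 (PV d ℓ i.m i.K hd hL)) U μ (fun s => A ⟨s, b.dir⟩) b.src := rfl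

/-- `‖covD … (ν-slice)(x)‖ = |c_f|⁻¹·‖(∇_{U,μ}A)(⟨x, ν⟩)‖` (`c_f ≠ 0` is a field of the index). [cite: Balaban1985BackgroundPropagators, (3.3) p.391, (3.39) p.397, bookkeeping] -/
theorem norm_covD_slice_eq (i : KIdx d ℓ hd hL b₀ b₁) (U : CfgY 𝔸 i) (μ : Fin (d + 1)) (A : FBondY i → 𝔸) (b : FBondY i) :
    ‖covD (shiftsV1 (PV d ℓ i.m i.K hd hL)) U μ (fun s => A ⟨s, b.dir⟩) b.src‖ = |i.cf|⁻¹ * ‖cdB i U μ A b‖ := by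
  rw [cdB_eq_smul_covD_slice, norm_smul, Complex.norm_real, Real.norm_eq_abs]
  have h : |i.cf| ≠ 0 := abs_ne_zero.mpr i.hcf
  field_simp

/-- ★ **def-Y's BOND-SECTOR READING**: for a `G`-valued configuration with unitary-like values and two bonds `x ∥ x′` of the SAME direction (the admissible pairs of def-Y's
`holderQB` are such), `‖A(x) − R(parBY i U x.src x′.src)A(x′)‖ ≤ (d+1)·|x.src − x′.src|_∞·|c_f|⁻¹·M` whenever `‖(∇_{U,μ}A)(b)‖ ≤ M` for every `μ` and every bond `b ∥ x` —
the mean-value step of (3.40) for the `x.dir`-component, at def-Y's genuine transporter. [cite: Balaban1985BackgroundPropagators, (3.40) p.397, (3.3) p.391, p.423] -/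
theorem norm_sub_R_parBY_le_of_cdB (i : KIdx d ℓ hd hL b₀ b₁) {U : CfgY 𝔸 i} (hU : ∀ μ s, UnitaryLike (U μ s)) (A : FBondY i → 𝔸) {M : ℝ} (hM : 0 ≤ M)
    (x x' : FBondY i) (hdir : x.dir = x'.dir)
    (h : ∀ (μ : Fin (d + 1)) (s : Site (PV d ℓ i.m i.K hd hL) 0), ‖cdB i U μ A ⟨s, x.dir⟩‖ ≤ M) :
    ‖A x - R (parBY i U x.src x'.src) (A x')‖ ≤ (d + 1) * supDist x.src x'.src * (|i.cf|⁻¹ * M) := by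
  obtain ⟨xs, xd⟩ := x
  obtain ⟨xs', xd'⟩ := x'
  dsimp only at hdir h ⊢
  subst hdir
  have key := norm_sub_R_parTaxiV_le_supDist (P := PV d ℓ i.m i.K hd hL) hU (fun s => A ⟨s, xd⟩) (δ := |i.cf|⁻¹ * M)
    (mul_nonneg (inv_nonneg.mpr (abs_nonneg _)) hM) (fun μ s => ?_) xs xs'
  · have hPd : (((PV d ℓ i.m i.K hd hL).d : ℕ) : ℝ) = (d : ℝ) + 1 := by
      rw [show (PV d ℓ i.m i.K hd hL).d = d + 1 from rfl, Nat.cast_succ]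
    rw [hPd] at key
    exact key
  · rw [norm_covD_slice_eq i U μ A ⟨s, xd⟩]
    exact mul_le_mul_of_nonneg_left (h μ s) (inv_nonneg.mpr (abs_nonneg _))

end

end Literature.MathematicalPhysics.QuantumFieldTheory.Balaban1983to89.B9Eq340TaxiTelescope
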